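import Literature.RingTheory.FittingIdeal.Functoriality
import Literature.RingTheory.FittingIdeal.Monotone
import Mathlib.RingTheory.LocalRing.Module
import Mathlib.RingTheory.LocalRing.ResidueField.Basic
import Mathlib.LinearAlgebra.Matrix.ToLinearEquiv
import Mathlib.LinearAlgebra.FiniteDimensional.Lemmas
import Mathlib.Algebra.Module.LocalizedModule.Submodule
import Mathlib.RingTheory.Localization.AtPrime.Basic
import HarnessLib

/-!
# Fitting ideals over local rings and at a prime (Stacks, Tag 07ZC; Eisenbud §20.2)

Topic: `Literature/RingTheory/FittingIdeal`. The pointwise meaning of the Fitting ideals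
`Fitt_k(M)` (`Literature.RingTheory.FittingIdeal.Module.fittingIdeal`, `Basic.lean`) of a finite
module — The Stacks Project, Tag 07ZC: "Let `R` be a ring. Let `M` be a finite `R`-module. Let
`k ≥ 0`. Let `𝔭 ⊂ R` be a prime ideal. The following are equivalent (1) `Fit_k(M) ⊄ 𝔭`,
(2) `dim_{κ(𝔭)} M ⊗_R κ(𝔭) ≤ k`, (3) `M_𝔭` can be generated by `k` elements over `R_𝔭` …"
(Eisenbud, *Commutative Algebra*, Prop. 20.6) — in the three forms used for the singular scheme
`Sing(f) = V(Fitt₁ Ω_{X/S})` of a semi-stable curve (de Jong 1996, 2.21;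
`Literature/AlgebraicGeometry/Resolution/AlterationsSemiStableThickness.lean`). All proved:

* `Module.fittingIdeal_eq_bot_of_lt_finrank` — over a field, `Fitt_k(V) = 0` for
  `k < dim V` (Stacks 07ZB: the Fitting ideals of a free module): `j` relations among `j + k`
  spanning vectors lie in a space of dimension `j + k - dim V < j`, so every `j × j` minor of
  them vanishes;
* `Module.fittingIdeal_le_maximalIdeal_of_lt_finrank` — over a local ring `(R, 𝔪, κ)`,
  `Fitt_k(M) ⊆ 𝔪` as soon as `k < dim_κ (κ ⊗ M)` (07ZC (1) ⇒ (2) at `𝔭 = 𝔪`, by base change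
  `Fitt_k(M) κ ⊆ Fitt_k(κ ⊗ M)`, `Functoriality.lean`);
* `Module.exists_span_eq_top_of_finrank_le`, `Module.exists_span_eq_top_of_fittingIdeal_eq_top`
  — Nakayama: `dim_κ (κ ⊗ M) ≤ k`, in particular `Fitt_k(M) = R`, forces `M` to be generated by
  `k` elements (07ZC (2) ⇒ (3), (1) ⇒ (3) for `R` local);
* `Module.exists_mem_fittingIdeal_notMem` — 07ZC (3) ⇒ (1): if a localization `M_𝔭` of the
  finite module `M` is generated by `k` elements over `R_𝔭`, then `Fitt_k(M) ⊄ 𝔭` (clearing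
  denominators, `sᵢ mᵢ = ∑ⱼ cᵢⱼ zⱼ` for generators `mᵢ` of `M` and numerators `zⱼ` of the `k`
  generators, a relation matrix with the invertible-at-`𝔭` minor `diag(sᵢ)`).

## Sources

* The Stacks Project, Tags 07ZB, 07ZC.
* D. Eisenbud, *Commutative Algebra with a View Toward Algebraic Geometry*, GTM 150 (1995),
  §20.2, Prop. 20.6.
-/

namespace Literature.RingTheory.FittingIdeal

open TensorProduct IsLocalRing

universe u v

/-! ## Over a field: `Fitt_k(V) = 0` for `k < dim V` -/

/-- **The Fitting ideals of a vector space** (Stacks 07ZB, the free case; Eisenbud §20.2): over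
a field `K`, `Fitt_k(V) = 0` whenever `k < dim_K V`. Indeed `j` relation vectors among a
spanning family of size `j + k` lie in the kernel of the surjection `K^{j+k} → V`, of dimension
`j + k - dim V < j`, so they are linearly dependent and all their `j × j` minors vanish.
[cite: StacksProject, Tag 07ZB] -/
theorem Module.fittingIdeal_eq_bot_of_lt_finrank (K : Type u) [Field K] (V : Type v)
    [AddCommGroup V] [Module K V] [FiniteDimensional K V] {k : ℕ}
    (hk : k < Module.finrank K V) : Module.fittingIdeal K V k = ⊥ := by
  classical
  rw [Module.fittingIdeal, Ideal.span_eq_bot]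
  rintro _ ⟨j, x, ρ, σ, hx, hρ, rfl⟩
  -- the surjection `c ↦ ∑ c_l • x_l` and its kernel
  let L : (Fin (j + k) → K) →ₗ[K] V := Fintype.linearCombination K x
  have hL : LinearMap.range L = ⊤ := by
    rw [Fintype.range_linearCombination, hx]
  have hker : Module.finrank K (LinearMap.ker L) + Module.finrank K V = j + k := by
    have h := LinearMap.finrank_range_add_finrank_ker L
    rw [hL, finrank_top, Module.finrank_fin_fun] at h
    omega
  have hρker : ∀ i, ρ i ∈ LinearMap.ker L := fun i => by
    rw [LinearMap.mem_ker]
    show Fintype.linearCombination K x (ρ i) = 0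
    rw [Fintype.linearCombination_apply]
    exact hρ i
  -- the `j` relation vectors are linearly dependent
  have hdep : ¬ LinearIndependent K ρ := by
    intro hli
    have hli' : LinearIndependent K (fun i => (⟨ρ i, hρker i⟩ : LinearMap.ker L)) :=
      LinearIndependent.of_comp (LinearMap.ker L).subtype hli
    have hcard := hli'.fintype_card_le_finrank
    rw [Fintype.card_fin] at hcard
    omega
  obtain ⟨c, hc, i₀, hi₀⟩ := Fintype.not_linearIndependent_iff.mp hdep
  -- hence `c ᵥ* N = 0` for the square matrix `N` of the minor, and `det N = 0`
  rw [← Matrix.exists_vecMul_eq_zero_iff]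
  refine ⟨c, fun h0 => hi₀ (by rw [h0, Pi.zero_apply]), ?_⟩
  ext i'
  have h := congrFun hc (σ i')
  rw [Finset.sum_apply, Pi.zero_apply] at h
  simp only [Matrix.vecMul, dotProduct, Matrix.of_apply, Pi.zero_apply]
  simpa only [Pi.smul_apply, smul_eq_mul] using h

/-! ## Over a local ring: `Fitt_k(M) ⊆ 𝔪` for `k < dim_κ (κ ⊗ M)`, and Nakayama -/

section LocalRing

variable {R : Type u} [CommRing R] [IsLocalRing R] {M : Type v} [AddCommGroup M] [Module R M]

/-- **Stacks 07ZC, (1) ⇒ (2) at the maximal ideal**: over a local ring `(R, 𝔪, κ)`, if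
`k < dim_κ (κ ⊗_R M)` then `Fitt_k(M) ⊆ 𝔪` — by base change, `Fitt_k(M) · κ ⊆ Fitt_k(κ ⊗ M) = 0`.
[cite: StacksProject, Tag 07ZC] -/
theorem Module.fittingIdeal_le_maximalIdeal_of_lt_finrank [Module.Finite R M] {k : ℕ}
    (hk : k < Module.finrank (ResidueField R) (ResidueField R ⊗[R] M)) :
    Module.fittingIdeal R M k ≤ maximalIdeal R := by
  have h1 := Module.map_fittingIdeal_le_baseChange (R := R) (M := M) (ResidueField R) k
  rw [Module.fittingIdeal_eq_bot_of_lt_finrank _ _ hk, le_bot_iff, Ideal.map_eq_bot_iff_le_ker]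
    at h1
  intro r hr
  have h2 := h1 hr
  rw [RingHom.mem_ker, ResidueField.algebraMap_eq, residue_eq_zero_iff] at h2
  exact h2

/-- **Nakayama, Stacks 07ZC (2) ⇒ (3) at the maximal ideal**: over a local ring `(R, 𝔪, κ)`, a
finite module `M` with `dim_κ (κ ⊗_R M) ≤ k` is generated by `k` elements (lift a basis of
`κ ⊗ M`, padded with zeros). [cite: StacksProject, Tag 07ZC] -/
theorem Module.exists_span_eq_top_of_finrank_le [Module.Finite R M] {k : ℕ}
    (hk : Module.finrank (ResidueField R) (ResidueField R ⊗[R] M) ≤ k) :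
    ∃ x : Fin k → M, Submodule.span R (Set.range x) = ⊤ := by
  -- a basis of `κ ⊗ M`, lifted to `M`
  let b := Module.finBasis (ResidueField R) (ResidueField R ⊗[R] M)
  have hsurj := TensorProduct.mk_surjective R M (ResidueField R) residue_surjective
  choose f hf using fun i => hsurj (b i)
  have hspan : Submodule.span R (Set.range f) = ⊤ :=
    span_eq_top_of_tmul_eq_basis f b fun i => hf i
  -- pad with zeros up to `k`
  let x : Fin k → M := fun i =>
    if h : (i : ℕ) < Module.finrank (ResidueField R) (ResidueField R ⊗[R] M) then f ⟨i, h⟩ else 0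
  refine ⟨x, top_le_iff.mp ?_⟩
  rw [← hspan]
  refine Submodule.span_mono ?_
  rintro _ ⟨i, rfl⟩
  refine ⟨⟨i, lt_of_lt_of_le i.2 hk⟩, ?_⟩
  simp [x]

/-- **Stacks 07ZC, (1) ⇒ (3) for a local ring**: if `Fitt_k(M) = R` for a finite module `M`
over a local ring, then `M` is generated by `k` elements. (The converse is
`Module.fittingIdeal_eq_top_of_span_eq_top`, `Basic.lean`.) [cite: StacksProject, Tag 07ZC] -/
theorem Module.exists_span_eq_top_of_fittingIdeal_eq_top [Module.Finite R M] {k : ℕ}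
    (h : Module.fittingIdeal R M k = ⊤) :
    ∃ x : Fin k → M, Submodule.span R (Set.range x) = ⊤ := by
  refine Module.exists_span_eq_top_of_finrank_le (not_lt.mp fun hk => ?_)
  have hle := Module.fittingIdeal_le_maximalIdeal_of_lt_finrank (R := R) (M := M) hk
  rw [h, top_le_iff] at hle
  exact (maximalIdeal.isMaximal R).ne_top hle

/-- Over a local ring, `Fitt₁(M) = R` for a finite module `M` iff `M` is cyclic.
[cite: StacksProject, Tag 07ZC] -/
theorem Module.fittingIdeal_one_eq_top_iff [Module.Finite R M] :
    Module.fittingIdeal R M 1 = ⊤ ↔ ∃ m : M, Submodule.span R {m} = ⊤ := by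
  constructor
  · intro h
    obtain ⟨x, hx⟩ := Module.exists_span_eq_top_of_fittingIdeal_eq_top h
    refine ⟨x 0, ?_⟩
    rw [← hx]
    congr 1
    ext m
    simp only [Set.mem_singleton_iff, Set.mem_range]
    constructor
    · rintro rfl
      exact ⟨0, rfl⟩
    · rintro ⟨i, rfl⟩
      rw [Fin.fin_one_eq_zero i]
  · rintro ⟨m, hm⟩
    refine Module.fittingIdeal_eq_top_of_span_eq_top (fun _ : Fin 1 => m) ?_
    rw [← hm]
    congr 1
    ext m'
    simp

end LocalRing

/-! ## At a prime: generation of `M_𝔭` by `k` elements gives `Fitt_k(M) ⊄ 𝔭` -/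

section AtPrime

variable {R : Type u} [CommRing R] {M : Type v} [AddCommGroup M] [Module R M]

/-- **Stacks 07ZC, (3) ⇒ (1)**: let `M` be a finite `R`-module, `𝔭` a prime, `R' = R_𝔭` and
`f : M → M'` a localization of `M` at `𝔭`. If `M'` is generated by `k` elements over `R'`, then
`Fitt_k(M) ⊄ 𝔭`. Proof: the `k` generators may be taken of the form `f(zⱼ)`; for generators
`m₁, …, mₙ` of `M`, clearing denominators gives `sᵢ mᵢ = ∑ⱼ cᵢⱼ zⱼ` with `sᵢ ∉ 𝔭`; these are
`n` relations among the `n + k` generators `(m, z)` of `M`, whose minor on the columns `m` is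
`det diag(sᵢ) = ∏ sᵢ ∉ 𝔭`. [cite: StacksProject, Tag 07ZC] -/
theorem Module.exists_mem_fittingIdeal_notMem [Module.Finite R M] (P : Ideal R) [P.IsPrime]
    (R' : Type*) [CommRing R'] [Algebra R R'] [IsLocalization.AtPrime R' P]
    {M' : Type*} [AddCommGroup M'] [Module R M'] [Module R' M'] [IsScalarTower R R' M']
    (f : M →ₗ[R] M') [IsLocalizedModule P.primeCompl f]
    {k : ℕ} (y : Fin k → M') (hy : Submodule.span R' (Set.range y) = ⊤) :
    ∃ d ∈ Module.fittingIdeal R M k, d ∉ P := by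
  classical
  -- numerators `z j` of the generators `y j`
  choose zt hzt using fun j => IsLocalizedModule.surj P.primeCompl f (y j)
  let z : Fin k → M := fun j => (zt j).1
  have hz : Submodule.span R' (Set.range (f ∘ z)) = ⊤ := by
    rw [eq_top_iff, ← hy, Submodule.span_le]
    rintro _ ⟨j, rfl⟩
    have hu := IsLocalization.map_units R' (zt j).2
    have hj : (algebraMap R R' ((zt j).2 : R)) • y j = f (z j) := by
      rw [algebraMap_smul]
      exact hzt j
    have h1 : y j = ((hu.unit⁻¹ : R'ˣ) : R') • f (z j) := by
      rw [← hj, smul_smul, Units.inv_mul_of_eq hu.unit_spec, one_smul]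
    rw [h1]
    exact Submodule.smul_mem _ _ (Submodule.subset_span ⟨j, rfl⟩)
  -- generators `m i` of `M` and the relations `s i • m i = ∑ j, c i j • z j`
  obtain ⟨n, m, hm⟩ := Module.Finite.exists_fin (R := R) (M := M)
  have hrel : ∀ i, ∃ (s : R) (c : Fin k → R), s ∉ P ∧ s • m i = ∑ j, c j • z j := by
    intro i
    have hmem : f (m i) ∈ (Submodule.span R (Set.range z)).localized' R' P.primeCompl f := by
      rw [Submodule.localized'_span, ← Set.range_comp, hz]
      exact Submodule.mem_top
    obtain ⟨n', hn', s, hs⟩ := (Submodule.mem_localized' R' P.primeCompl f _ _).mp hmem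
    rw [IsLocalizedModule.mk'_eq_iff, Submonoid.smul_def, ← map_smul] at hs
    -- hs : f n' = f (s • m i)
    obtain ⟨c', hc'⟩ := IsLocalizedModule.exists_of_eq (S := P.primeCompl) (f := f) hs
    obtain ⟨c, hc⟩ := (Submodule.mem_span_range_iff_exists_fun R).mp hn'
    refine ⟨(c' : R) * (s : R), fun j => (c' : R) * c j, ?_, ?_⟩
    · exact fun h => ((P.primeCompl).mul_mem c'.2 s.2) h
    · rw [mul_smul]
      change (c' : R) • ((s : R) • m i) = _
      have h2 : (c' : R) • ((s : R) • m i) = (c' : R) • n' := by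
        have := hc'
        simp only [Submonoid.smul_def] at this
        exact this.symm
      rw [h2, ← hc, Finset.smul_sum]
      refine Finset.sum_congr rfl fun j _ => ?_
      rw [smul_smul]
  choose s c hs hsc using hrel
  -- the generating family `(m, z)` of size `n + k` and its `n` relations
  let X : Fin (n + k) → M := Fin.append m z
  have hX : Submodule.span R (Set.range X) = ⊤ := by
    rw [eq_top_iff, ← hm, Submodule.span_le]
    rintro _ ⟨i, rfl⟩
    exact Submodule.subset_span ⟨Fin.castAdd k i, by simp [X]⟩
  let ρ : Fin n → Fin (n + k) → R := fun i => Fin.append (Pi.single i (s i)) (fun j => -c i j)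
  have hρ : ∀ i, ∑ l, ρ i l • X l = 0 := by
    intro i
    rw [Fin.sum_univ_add]
    simp only [ρ, X, Fin.append_left, Fin.append_right]
    rw [Finset.sum_eq_single i (fun i' _ hi' => by rw [Pi.single_eq_of_ne hi', zero_smul])
      (fun h => absurd (Finset.mem_univ i) h), Pi.single_eq_same, hsc i, ← Finset.sum_add_distrib]
    refine Finset.sum_eq_zero fun j _ => ?_
    rw [neg_smul, add_neg_cancel]
  refine ⟨∏ i, s i, ?_, fun h => ?_⟩
  · have hdet := Module.det_mem_fittingIdeal (R := R) (M := M) X hX ρ hρ (Fin.castAddEmb k)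
    have hmat : (Matrix.of fun i i' => ρ i (Fin.castAddEmb k i')) = Matrix.diagonal s := by
      ext i i'
      simp only [Matrix.of_apply, Fin.castAddEmb_apply, ρ, Fin.append_left, Matrix.diagonal_apply,
        Pi.single_apply]
      by_cases h : i = i'
      · subst h
        simp
      · rw [if_neg (Ne.symm h), if_neg h]
    rw [hmat, Matrix.det_diagonal] at hdet
    exact hdet
  · have hmem : (∏ i, s i) ∈ P.primeCompl :=
      prod_mem fun i _ => show s i ∈ P.primeCompl from hs i
    exact hmem h

end AtPrime

end Literature.RingTheory.FittingIdeal
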